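import Mathlib
import Literature.AlgebraicGeometry.Resolution.ResolutionOfSingularities
import Literature.AlgebraicGeometry.Resolution.ResolutionGlue
import Summits.ResolutionOfSingularities.ResolutionOfSingularities.Theorems.FrobeniusLadderFRationalResolutionAffineSpaceBirational
import HarnessLib

/-!
# Off-locus resolution data restrict along open immersions
(crux `FrobeniusLadder.FRationalResolution`, line `Sketch`)

Stub `stub_offLocus_resolution_restrict` of the skeleton `Sketch` for crux
stmt-ResolutionOfSingularities-15317 (theme: resolution is Zariski-local for isolated singular
points). Given "off-locus resolution data" for a scheme `X` and an open `UX ⊆ X` — a proper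
`π : X' ⟶ X` from a regular scheme which is an isomorphism over `UX` with dense preimage
`π⁻¹(UX)` — and an open immersion `j : A ⟶ X` (a Zariski neighbourhood), the base change
`ρ : A' := X' ×_X A ⟶ A` of `π` along `j` is again such data for `A` and the open `j⁻¹(UX)`:

* `ρ` is proper (base change);
* `A'` is regular, since `A' ⟶ X'` is an open immersion (base change of `j`) and open immersions
  induce isomorphisms on local rings;
* `ρ` is an isomorphism over `j⁻¹(UX)` ("isomorphism over an open" is stable under base change,
  `isIso_morphismRestrict_preimage_of_isPullback`);
* `ρ⁻¹(j⁻¹(UX))` is the preimage of the dense open `π⁻¹(UX)` under the open immersion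
  `A' ⟶ X'`, hence dense (`Dense.preimage`).
-/

set_option linter.dupNamespace false

noncomputable section

open CategoryTheory CategoryTheory.Limits AlgebraicGeometry TopologicalSpace
  Literature.AlgebraicGeometry.Resolution

namespace Summit.ResolutionOfSingularities.ResolutionOfSingularities.Theorems.FRationalResolution

/-- OFF-LOCUS RESOLUTION DATA RESTRICT ALONG OPEN IMMERSIONS. If `X` admits a proper morphism
`π : X' ⟶ X` from a regular scheme which is an isomorphism over an open `UX ⊆ X` with dense
preimage, then for every open immersion `j : A ⟶ X` the scheme `A` admits a proper morphism
`ρ : A' ⟶ A` from a regular scheme which is an isomorphism over `j⁻¹(UX)` with dense preimage: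
take the base change `A' := X' ×_X A` of `π` along `j`. [folklore; Stacks 01W0 (base change of
proper), 02IS (regular schemes)] -/
theorem stub_offLocus_resolution_restrict (X A : Scheme.{0}) (j : A ⟶ X) [IsOpenImmersion j]
    (UX : X.Opens)
    (h : ∃ (X' : Scheme.{0}) (π : X' ⟶ X), IsProper π ∧ Scheme.IsRegular X' ∧ IsIso (π ∣_ UX) ∧
      Dense ((π ⁻¹ᵁ UX : X'.Opens) : Set X')) :
    ∃ (A' : Scheme.{0}) (ρ : A' ⟶ A), IsProper ρ ∧ Scheme.IsRegular A' ∧ IsIso (ρ ∣_ (j ⁻¹ᵁ UX)) ∧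
      Dense ((ρ ⁻¹ᵁ (j ⁻¹ᵁ UX) : A'.Opens) : Set A') := by
  obtain ⟨X', π, hπ, hreg, hiso, hd⟩ := h
  haveI := hπ
  -- the cartesian square `pullback.snd ≫ j = pullback.fst ≫ π`
  have H : IsPullback (pullback.snd π j) (pullback.fst π j) j π :=
    (IsPullback.of_hasPullback π j).flip
  refine ⟨pullback π j, pullback.snd π j, inferInstance, ?_, ?_, ?_⟩
  · -- `pullback.fst π j : pullback π j ⟶ X'` is an open immersion into a regular scheme
    intro x
    haveI := hreg (pullback.fst π j x)
    exact IsRegularLocalRing.of_ringEquiv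
      (asIso ((pullback.fst π j).stalkMap x)).commRingCatIsoToRingEquiv
  · exact isIso_morphismRestrict_preimage_of_isPullback H UX hiso
  · have hpre : pullback.snd π j ⁻¹ᵁ (j ⁻¹ᵁ UX) = pullback.fst π j ⁻¹ᵁ (π ⁻¹ᵁ UX) := by
      rw [← Scheme.Hom.comp_preimage, ← pullback.condition, Scheme.Hom.comp_preimage]
    rw [hpre]
    exact hd.preimage (pullback.fst π j).isOpenEmbedding.isOpenMap

end Summit.ResolutionOfSingularities.ResolutionOfSingularities.Theorems.FRationalResolution

end
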